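import Summits.BirchSwinnertonDyer.BirchSwinnertonDyer.Theorems.EdixhovenFibreFiveSevenStarredOptimalManinUnitFiveSevenRecTowerAtCyclotomicFromAbove
import Literature.NumberTheory.PAdicHodge.DeRhamRestrictedTateRepTower
import Literature.NumberTheory.PAdicHodge.NeronDeRhamDatumOfDeRham
import Literature.NumberTheory.PAdicHodge.KatoH1BdRFilHolds
import Literature.NumberTheory.EllipticCurves.PadicLogFiniteExtensionEquivProofs
import Literature.NumberTheory.GaloisRepresentations.LocalGaloisGroupInertiaProofs
import Summits.BirchSwinnertonDyer.BirchSwinnertonDyer.Theorems.EdixhovenFibreFiveSevenStarredOptimalManinUnitFiveSevenSupersingularCellsDeRhamHolds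
import Summits.BirchSwinnertonDyer.BirchSwinnertonDyer.Theorems.EdixhovenFibreFiveSevenStarredOptimalManinUnitFiveSevenOrdinaryCellsDeRham
import HarnessLib

/-!
# [REC-tower] AT THE CYCLOTOMIC TOWER `ℚ_v ⊆ ℚ(ζ_m)_w` from Kato's formula over an ABSTRACT finite `K′ ⊇ ℚ(ζ_m)_w`
# — the K′-PACKAGE: every K′-level plumbing input of `…RecTowerAtCyclotomicFromAbove` DISCHARGED
# (route `EdixhovenFibreFiveSeven`, crux K★ stmt-BirchSwinnertonDyer-22226, line `kato-lever`; seat `bsd-line-edix-p1` g30, LEAD)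

HONEST FRAMING. TOOL theorem only (no definition, no named fact, no instance, no `sorry`; file-local instance keys on `ℚ_v`
byte-identical to `…RecTowerAtCyclotomicFromAbove` l.62–67); nothing is closed; BSD / K★ / the REC stubs are NOT proved by this.

WHAT. `…RecTowerAtCyclotomicFromAbove.recTowerAt_cyclotomic_of_formula_above` (p782748, LEAD g29) displays, besides the stub's own
binders, a «K′-package»: for the finite `K′ ⊇ L_w = ℚ(ζ_m)_w` over which a cell proves Kato's formula, the intertwiners `gV`, `gV′`, the
Prop-1.2.3 binders `hinj′`/`hde′` of the tower representation over `K′`, a line datum `d′` over `K′` with its compatibility clause `hcomp′`,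
and the functorialities `hlog`, `hlog′` of `log_ω`. ★★★ `recTowerAt_cyclotomic_of_formula_over_ext` DISCHARGES ALL OF THEM for an
ABSTRACT `K′` carrying only: its local-field instances, `[Algebra L_w K′]` with `Continuous (algebraMap L_w K′)`, `[FiniteDimensional L_w K′]`,
the CANONICAL `ℚ_p`-structure `LocalField.padicAlgebra K′ p hp′`, a compatible valuation `w′` with `W ⊗ K′` integral, and ONE de Rham input
at `ℚ_v` (`hDRv`, a tree theorem on every K★ cell). What is left displayed is exactly the OUTPUT SHAPE of the (K₂)^ram road (T5-A/B/C/D,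
`…TransportedReciprocityAllPoints`, after its transport T5-E to `W` itself): for EVERY line datum `d″` of the DIRECT representation
`V_pW|_{Γ_{K′}}` SOME constant `c′ ∈ K′` with `⟨[η″], P′⟩ = Tr_{K′/ℚ_p}(c′ · exp*_{d″}(η″) · log_ω P′)` for all `η″ ∈ Z¹(Γ_{K′}, T_pW)`,
`P′ ∈ E(K′)`.

HOW (all tree): `gV`, `gV′` = `DualExpEllipticRestriction.exists_ratGalEquiv`; `IsScalarTower ℚ_p L_w K′` =
`KimAtThreeDeepLowerExpStarOmegaRes.isScalarTower_padicAlgebra_of_continuous`; de Rham ASCENT `ℚ_v → L_w → K′` =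
`DeRhamRestrictedTateRepTower.isDeRham_restrictedRationalTateRep_of_tower` (Brinon–Conrad 6.3.8), tower-vs-direct by
`PeriodRingData.isAdmissible_iff_of_equiv` along `gV′`; Prop-1.2.3 = `cupLogInjective_and_hasDualExp_of_isDeRham_holds` (Kato II Prop. 1.2.3,
PROVED in the tree); EXISTENCE of a line over `K′` = `nonempty_filZeroLine_of_isDeRham_of_det` (`dim D⁰_dR = 1` for a 2-dimensional de Rham `V`
with `det = χ`); `d′` + `hcomp′` = (RES) `exists_localNeronLine_expStarOmega_res` at the base `L_w`, read on cocycles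
(`expStarOmega_oneCocycleClass`, `cohomologyRes_oneCocycleClass`); `hlog`/`hlog′` = `ReciprocityLawDescent.padicLogPointFiniteExt_map_toAlgHom` for the
ISOMETRIC pair `(ν ∘ algebraMap, ν)` resp. `(w′ ∘ algebraMap, w′)` after `padicLogPointFiniteExt_eq_of_isEquiv`, the restricted valuation being
compatible by AUTOMATIC CONTINUITY (`valuativeExtension_of_cast_residueFieldCard_eq_zero cast_residueFieldCard_eq_zero_of_algebra`: every
algebra map of `p`-adic fields is a valuative extension; Mathlib `ValuativeExtension.compatible_comap`).

APPENDED (same seat, same day): ★ `isDeRham_place_of_starredCell` — the de Rham input `hDRv` HOLDS on the six starred K★ cells (the tree's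
cell theorems `isDeRham_restrictedRationalTateRep_adicCompletion_rat_of_starred_fiveSeven_ordinary` / `isDeRham_supersingularCells_of_explicitCapstone
explicitCapstone_holds`, re-keyed to the packet's `ℚ`-algebra structure on `ℚ_v`); ★★★ `recTowerAt_cyclotomic_cells_of_formula_over_ext` — hence on
the cells (the hypotheses of the intrinsic REC stubs of skeleton v8, NO ordinary/supersingular selector) the [REC-tower] body clause follows from a
finite `K′ ⊇ ℚ(ζ_m)_w` with keys + Kato's formula over `K′` for the direct representation (`∀ d″ ∃ c′`) AND NOTHING ELSE.

References: [Kato1993LNM1553] Ch. II §1.2.4, Prop. 1.2.3, Ex. 1.3.5, Thm. 1.4.1 (4); [BrinonConrad2009] Prop. 6.3.8;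
[SerreLocalFields1979] II §4, XIII §3 Prop. 7; [SilvermanAEC2009] Thm. IV.6.4, Prop. VII.2.2; [Fontaine1982FormesDifferentielles] §5;
[DokchitserDokchitser2015LocalInvariants] Thm. 3.2.
-/

set_option autoImplicit false
-- the Theorems namespace of a single-conjunct summit repeats the summit name by design (D-0017)
set_option linter.dupNamespace false

noncomputable section

open scoped Classical NNReal TensorProduct NumberField
open CategoryTheory Function Field ValuativeRel IsDedekindDomain NumberField
open Literature.NumberTheory.GaloisRepresentations
open Literature.NumberTheory.GaloisRepresentations.IsNonarchimedeanLocalField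
open Literature.NumberTheory.GaloisRepresentations.PeriodRingData
open Literature.NumberTheory.PAdicHodge
open Literature.NumberTheory.EllipticCurves _root_.WeierstrassCurve
open Literature.NumberTheory.EllipticCurves.FormalGroupChart (padicLogPointFiniteExt padicLogPointFiniteExt_eq_of_isEquiv isIntegral_of_isEquiv)
open Summit.BirchSwinnertonDyer.BirchSwinnertonDyer.Theorems.StarredOptimalManinUnitFiveSevenReciprocityTowerFromAbove
open Summit.BirchSwinnertonDyer.BirchSwinnertonDyer.Theorems.StarredOptimalManinUnitFiveSevenRecTowerAtCyclotomicFromAbove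
open Summit.BirchSwinnertonDyer.BirchSwinnertonDyer.Theorems.KimAtThreeDeepLowerExpStarOmega
open Summit.BirchSwinnertonDyer.BirchSwinnertonDyer.Theorems.KimAtThreeDeepLowerExpStarOmegaPlace
open Summit.BirchSwinnertonDyer.BirchSwinnertonDyer.Theorems.KimAtThreeDeepLowerExpStarOmegaRes
open Summit.BirchSwinnertonDyer.BirchSwinnertonDyer.Theorems.KimAtThreeDeepUpperTowerLattice (fact_natCast_mem_primesEquiv_symm)
open Summit.BirchSwinnertonDyer.BirchSwinnertonDyer.Theorems.KPort
open Summit.BirchSwinnertonDyer.Rank1Residual.GaloisImage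
open Rat.HeightOneSpectrum Literature.NumberTheory.DiophantineGeometry
open Summit.BirchSwinnertonDyer.Rank1Residual Summit.BirchSwinnertonDyer.Rank1Residual.Additive
  Literature.NumberTheory.EllipticCurves.Rank1Residual
open Literature.NumberTheory.AdelicBaseChange

namespace Summit.BirchSwinnertonDyer.BirchSwinnertonDyer.Theorems.StarredOptimalManinUnitFiveSevenRecTowerAtCyclotomicOverExt

variable (W : WeierstrassCurve ℚ) [W.IsElliptic] (p : ℕ) [hp : Fact p.Prime]

-- FILE-LOCAL instance keys, byte-identical to the accepted `…RecTowerAtCyclotomicFromAbove.lean` l.62–67 (no library instance is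
-- overridden outside this file): the `Fact (p ∈ v_p)` key and the local-field structures on `ℚ_v = Place.Completion (inr v_p)`.
attribute [local instance] fact_natCast_mem_primesEquiv_symm
attribute [local instance 100000] NumberField.Place.instAlgebraCompletion
attribute [local instance] valuativeRelPlace topologicalSpacePlace
attribute [local instance] isNonarchimedeanLocalField_place charZero_place
attribute [local instance] padicAlgebraPlace fact_not_isUnit_place isAdicComplete_place

set_option maxHeartbeats 400000 in
set_option backward.isDefEq.respectTransparency false in
/-- ★★★ **[REC-tower] at the cyclotomic tower `ℚ_v ⊆ ℚ(ζ_m)_w` from Kato's formula over an ABSTRACT finite `K′ ⊇ ℚ(ζ_m)_w` — the K′-package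
discharged.** Inputs: the stub's own binders (`wv`, `ν`, the Weil tower, `hnondeg`, the Prop-1.2.3 binders `hinj`/`hde` of the tower
representation over `L_w`, `d₀`, `d`, `hcomp`); ONE de Rham input `hDRv` at `ℚ_v`; a finite `K′ ⊇ L_w` (local-field instances,
`Continuous (algebraMap L_w K′)`, `FiniteDimensional L_w K′`, the canonical `ℚ_p`-structure, a compatible `w′` with `W ⊗ K′` integral); and Kato's
formula over `K′` for the DIRECT representation — for every line datum `d″` some constant `c′`. Output: the [REC-tower] body clause
`∃ c₀ ≠ 0, lower ∧ upper` of the stubs of skeleton v8 at `(W, ℚ_v ⊆ L_w, wv, ν, e, d₀, d)`.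
[cite: Kato1993LNM1553, Ch. II §1.2.4, Prop. 1.2.3, Ex. 1.3.5 and Thm. 1.4.1 (4)] [cite: BrinonConrad2009, Prop. 6.3.8]
[cite: SerreLocalFields1979, II §4 and XIII §3 Prop. 7] [cite: SilvermanAEC2009, Thm. IV.6.4 with Prop. VII.2.2] -/
theorem recTowerAt_cyclotomic_of_formula_over_ext
    (hDRv : GaloisRep.IsDeRham (bdRPeriodRingData (valuation_place_lt_one p ((primesEquiv (R := 𝓞 ℚ)).symm ⟨p, hp.out⟩)))
      (localRationalTateRep W p (galRestrictPlace ((primesEquiv (R := 𝓞 ℚ)).symm ⟨p, hp.out⟩))))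
    (m : ℕ) [NeZero m]
    (w : ((primesEquiv (R := 𝓞 ℚ)).symm ⟨p, hp.out⟩).Extension (𝓞 (CyclotomicField m ℚ)))
    (hw : ((p : ℕ) : 𝓞 (CyclotomicField m ℚ)) ∈ w.1.asIdeal)
    [CharZero (w.1.adicCompletion (CyclotomicField m ℚ))]
    [Fact (¬ IsUnit ((p : ℕ) : integerC (w.1.adicCompletion (CyclotomicField m ℚ))))]
    [IsAdicComplete (Ideal.span {((p : ℕ) : integerC (w.1.adicCompletion (CyclotomicField m ℚ)))}) (integerC (w.1.adicCompletion (CyclotomicField m ℚ)))]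
    (hL : valuation (w.1.adicCompletion (CyclotomicField m ℚ)) ((p : ℕ) : (w.1.adicCompletion (CyclotomicField m ℚ))) < 1) :
    letI := LocalField.adicCompletionPadicAlgebra w.1 p hw
    letI : Algebra (Place.Completion (K := ℚ) (Sum.inr ((primesEquiv (R := 𝓞 ℚ)).symm ⟨p, hp.out⟩))) (w.1.adicCompletion (CyclotomicField m ℚ)) :=
      inferInstanceAs (Algebra (((primesEquiv (R := 𝓞 ℚ)).symm ⟨p, hp.out⟩).adicCompletion ℚ) (w.1.adicCompletion (CyclotomicField m ℚ)))
    ∀ (wv : Valuation (Place.Completion (Sum.inr ((primesEquiv (R := 𝓞 ℚ)).symm ⟨p, hp.out⟩) : Place ℚ)) ℝ≥0) [wv.Compatible] [(W.baseChange (Place.Completion (Sum.inr ((primesEquiv (R := 𝓞 ℚ)).symm ⟨p, hp.out⟩) : Place ℚ))).IsIntegral wv.integer]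
      (ν : Valuation (w.1.adicCompletion (CyclotomicField m ℚ)) ℝ≥0) [ν.Compatible] [(W.baseChange (w.1.adicCompletion (CyclotomicField m ℚ))).IsIntegral ν.integer]
      -- the ABSTRACT upper field `K′ ⊇ L_w` with the CANONICAL `ℚ_p`-structure
      {K' : Type} [Field K'] [Algebra ℚ K'] [Algebra (w.1.adicCompletion (CyclotomicField m ℚ)) K'] [IsScalarTower ℚ (w.1.adicCompletion (CyclotomicField m ℚ)) K'] [ValuativeRel K'] [TopologicalSpace K']
      [IsNonarchimedeanLocalField K'] [CharZero K'] [Fact (¬ IsUnit (p : integerC K'))]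
      [IsAdicComplete (Ideal.span {(p : integerC K')}) (integerC K')]
      (hp' : valuation K' p < 1) (hcont' : Continuous (algebraMap (w.1.adicCompletion (CyclotomicField m ℚ)) K')) [FiniteDimensional (w.1.adicCompletion (CyclotomicField m ℚ)) K']
      (w' : Valuation K' ℝ≥0) [w'.Compatible] [(W.baseChange K').IsIntegral w'.integer],
    letI := LocalField.padicAlgebra K' p hp'
    -- the Weil tower
    ∀ (e : (k : ℕ) → geomTorsion W ((p ^ k : ℕ) : ℤ) → geomTorsion W ((p ^ k : ℕ) : ℤ) → AlgebraicClosure ℚ)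
    (hμ : ∀ k S T, e k S T ^ (p ^ k) = 1) (hadd₁ : ∀ k S₁ S₂ T, e k (S₁ + S₂) T = e k S₁ T * e k S₂ T)
    (hadd₂ : ∀ k S T₁ T₂, e k S (T₁ + T₂) = e k S T₁ * e k S T₂)
    (hgal : ∀ k (σ : absoluteGaloisGroup ℚ) (S T : geomTorsion W ((p ^ k : ℕ) : ℤ)), σ • e k S T = e k (σ • S) (σ • T))
    (hcompat : ∀ k (S T : geomTorsion W ((p ^ (k + 1) : ℕ) : ℤ)),
      e k (torsionMulHom W (p ^ (k + 1)) (p ^ k) p (pow_succ p k).symm S)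
        (torsionMulHom W (p ^ (k + 1)) (p ^ k) p (pow_succ p k).symm T) = e (k + 1) S T ^ p)
    (hnondeg : ∀ k (T : geomTorsion W ((p ^ k : ℕ) : ℤ)), (∀ S, e k S T = 1) → T = 0)
    -- binders of the tower representation over `F = L_w` (relative to `F₀ = ℚ_v`) — the stub's own
    (hinj : (bdRPeriodRingData (F := (w.1.adicCompletion (CyclotomicField m ℚ))) (p := p) hL).CupLogInjective (logCyclotomic p)
      ((restrictedRationalTateRep W (Place.Completion (Sum.inr ((primesEquiv (R := 𝓞 ℚ)).symm ⟨p, hp.out⟩) : Place ℚ)) p).restrict (absGaloisRestrict (Place.Completion (Sum.inr ((primesEquiv (R := 𝓞 ℚ)).symm ⟨p, hp.out⟩) : Place ℚ)) (w.1.adicCompletion (CyclotomicField m ℚ)))))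
    (hde : ∀ z : contOneCocycles ((restrictedRationalTateRep W (Place.Completion (Sum.inr ((primesEquiv (R := 𝓞 ℚ)).symm ⟨p, hp.out⟩) : Place ℚ)) p).restrict (absGaloisRestrict (Place.Completion (Sum.inr ((primesEquiv (R := 𝓞 ℚ)).symm ⟨p, hp.out⟩) : Place ℚ)) (w.1.adicCompletion (CyclotomicField m ℚ)))).toTopRep,
      (bdRPeriodRingData (F := (w.1.adicCompletion (CyclotomicField m ℚ))) (p := p) hL).HasDualExp (logCyclotomic p)
        ((restrictedRationalTateRep W (Place.Completion (Sum.inr ((primesEquiv (R := 𝓞 ℚ)).symm ⟨p, hp.out⟩) : Place ℚ)) p).restrict (absGaloisRestrict (Place.Completion (Sum.inr ((primesEquiv (R := 𝓞 ℚ)).symm ⟨p, hp.out⟩) : Place ℚ)) (w.1.adicCompletion (CyclotomicField m ℚ)))) fun σ => z.1 σ)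
    -- line data at `ℚ_v` and `L_w` with their compatibility — the stub's own
    (d₀ : (bdRPeriodRingData (F := (Place.Completion (Sum.inr ((primesEquiv (R := 𝓞 ℚ)).symm ⟨p, hp.out⟩) : Place ℚ))) (p := p) (valuation_place_lt_one p ((primesEquiv (R := 𝓞 ℚ)).symm ⟨p, hp.out⟩))).FilZeroLine (restrictedRationalTateRep W (Place.Completion (Sum.inr ((primesEquiv (R := 𝓞 ℚ)).symm ⟨p, hp.out⟩) : Place ℚ)) p))
    (d : (bdRPeriodRingData (F := (w.1.adicCompletion (CyclotomicField m ℚ))) (p := p) hL).FilZeroLine ((restrictedRationalTateRep W (Place.Completion (Sum.inr ((primesEquiv (R := 𝓞 ℚ)).symm ⟨p, hp.out⟩) : Place ℚ)) p).restrict (absGaloisRestrict (Place.Completion (Sum.inr ((primesEquiv (R := 𝓞 ℚ)).symm ⟨p, hp.out⟩) : Place ℚ)) (w.1.adicCompletion (CyclotomicField m ℚ)))))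
    (hcomp : ∀ (η₀ : contOneCocycles (restrictedTateRep W (Place.Completion (Sum.inr ((primesEquiv (R := 𝓞 ℚ)).symm ⟨p, hp.out⟩) : Place ℚ)) p).toTopRep)
        (η : contOneCocycles ((restrictedTateRep W (Place.Completion (Sum.inr ((primesEquiv (R := 𝓞 ℚ)).symm ⟨p, hp.out⟩) : Place ℚ)) p).restrict (absGaloisRestrict (Place.Completion (Sum.inr ((primesEquiv (R := 𝓞 ℚ)).symm ⟨p, hp.out⟩) : Place ℚ)) (w.1.adicCompletion (CyclotomicField m ℚ)))).toTopRep),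
        (∀ σ, η.1 σ = η₀.1 (absGaloisRestrict (Place.Completion (Sum.inr ((primesEquiv (R := 𝓞 ℚ)).symm ⟨p, hp.out⟩) : Place ℚ)) (w.1.adicCompletion (CyclotomicField m ℚ)) σ)) →
        expStarCoordTower W hL d η = algebraMap (Place.Completion (Sum.inr ((primesEquiv (R := 𝓞 ℚ)).symm ⟨p, hp.out⟩) : Place ℚ)) (w.1.adicCompletion (CyclotomicField m ℚ)) (expStarCoord W (valuation_place_lt_one p ((primesEquiv (R := 𝓞 ℚ)).symm ⟨p, hp.out⟩)) d₀ η₀))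
    -- Kato's formula over `K′` for the DIRECT representation: for every line datum SOME constant (the (K₂)^ram road's output shape)
    (hrecK' : ∀ d'' : (bdRPeriodRingData (F := K') (p := p) hp').FilZeroLine (restrictedRationalTateRep W K' p), ∃ c' : K',
      ∀ (η'' : contOneCocycles (restrictedTateRep W K' p).toTopRep) (P' : (W.baseChange K').toAffine.Point),
      ((tatePairingPoint W K' p e hμ hadd₁ hadd₂ hgal hcompat (oneCocycleClass _ η'') P' : ℤ_[p]) : ℚ_[p]) =
        Algebra.trace ℚ_[p] K' (c' * expStarCoord W hp' d'' η'' * padicLogPointFiniteExt w' (W.baseChange K') p P')),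
    ∃ c₀ : (Place.Completion (Sum.inr ((primesEquiv (R := 𝓞 ℚ)).symm ⟨p, hp.out⟩) : Place ℚ)), c₀ ≠ 0 ∧
      (∀ (η₀ : contOneCocycles (restrictedTateRep W (Place.Completion (Sum.inr ((primesEquiv (R := 𝓞 ℚ)).symm ⟨p, hp.out⟩) : Place ℚ)) p).toTopRep) (P₀ : (W.baseChange (Place.Completion (Sum.inr ((primesEquiv (R := 𝓞 ℚ)).symm ⟨p, hp.out⟩) : Place ℚ))).toAffine.Point),
        ((tatePairingPoint W (Place.Completion (Sum.inr ((primesEquiv (R := 𝓞 ℚ)).symm ⟨p, hp.out⟩) : Place ℚ)) p e hμ hadd₁ hadd₂ hgal hcompat (oneCocycleClass _ η₀) P₀ : ℤ_[p]) : ℚ_[p]) =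
          Algebra.trace ℚ_[p] (Place.Completion (Sum.inr ((primesEquiv (R := 𝓞 ℚ)).symm ⟨p, hp.out⟩) : Place ℚ))
            (c₀ * expStarCoord W (valuation_place_lt_one p ((primesEquiv (R := 𝓞 ℚ)).symm ⟨p, hp.out⟩)) d₀ η₀ * padicLogPointFiniteExt wv (W.baseChange (Place.Completion (Sum.inr ((primesEquiv (R := 𝓞 ℚ)).symm ⟨p, hp.out⟩) : Place ℚ))) p P₀)) ∧
      ∀ (η : contOneCocycles ((restrictedTateRep W (Place.Completion (Sum.inr ((primesEquiv (R := 𝓞 ℚ)).symm ⟨p, hp.out⟩) : Place ℚ)) p).restrict (absGaloisRestrict (Place.Completion (Sum.inr ((primesEquiv (R := 𝓞 ℚ)).symm ⟨p, hp.out⟩) : Place ℚ)) (w.1.adicCompletion (CyclotomicField m ℚ)))).toTopRep)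
        (P : (W.baseChange (w.1.adicCompletion (CyclotomicField m ℚ))).toAffine.Point),
        ((tatePairingPointTower W (Place.Completion (Sum.inr ((primesEquiv (R := 𝓞 ℚ)).symm ⟨p, hp.out⟩) : Place ℚ)) e hμ hadd₁ hadd₂ hgal hcompat (oneCocycleClass _ η) P : ℤ_[p]) : ℚ_[p]) =
          Algebra.trace ℚ_[p] (w.1.adicCompletion (CyclotomicField m ℚ))
            (algebraMap (Place.Completion (Sum.inr ((primesEquiv (R := 𝓞 ℚ)).symm ⟨p, hp.out⟩) : Place ℚ)) (w.1.adicCompletion (CyclotomicField m ℚ)) c₀ * expStarCoordTower W hL d η * padicLogPointFiniteExt ν (W.baseChange (w.1.adicCompletion (CyclotomicField m ℚ))) p P) := by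
  intro wv _ _ ν _ _ K' _ _ _ _ _ _ _ _ _ _ hp' hcont' _ w' _ _ e hμ hadd₁ hadd₂ hgal hcompat hnondeg hinj hde d₀ d hcomp hrecK'
  letI := LocalField.adicCompletionPadicAlgebra w.1 p hw
  letI instEF : Algebra (Place.Completion (K := ℚ) (Sum.inr ((primesEquiv (R := 𝓞 ℚ)).symm ⟨p, hp.out⟩))) (w.1.adicCompletion (CyclotomicField m ℚ)) :=
    inferInstanceAs (Algebra (((primesEquiv (R := 𝓞 ℚ)).symm ⟨p, hp.out⟩).adicCompletion ℚ) (w.1.adicCompletion (CyclotomicField m ℚ)))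
  letI := LocalField.padicAlgebra K' p hp'
  -- §0 instances of the two towers
  have hcont : Continuous (algebraMap (Place.Completion (Sum.inr ((primesEquiv (R := 𝓞 ℚ)).symm ⟨p, hp.out⟩) : Place ℚ)) (w.1.adicCompletion (CyclotomicField m ℚ))) := w.adicCompletionSemialgHom_continuous ℚ (CyclotomicField m ℚ)
  haveI : IsScalarTower ℚ_[p] (Place.Completion (Sum.inr ((primesEquiv (R := 𝓞 ℚ)).symm ⟨p, hp.out⟩) : Place ℚ)) (w.1.adicCompletion (CyclotomicField m ℚ)) := isScalarTower_padicAlgebra_of_continuous p hcont (valuation_place_lt_one p ((primesEquiv (R := 𝓞 ℚ)).symm ⟨p, hp.out⟩)) hL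
  haveI : IsScalarTower ℚ_[p] (w.1.adicCompletion (CyclotomicField m ℚ)) K' := isScalarTower_padicAlgebra_of_continuous p hcont' hL hp'
  haveI : Module.Finite ℚ_[p] (W.rationalTateModule p) := module_finite_rationalTateModule_holds W p
  have hp0 : (p : ℚ) ≠ 0 := Nat.cast_ne_zero.mpr hp.out.ne_zero
  -- §1 the intertwiners `V(γ⁻¹)` of the two towers
  obtain ⟨gV, hgVdef⟩ := exists_ratGalEquiv W (p := p) (towerConjElement ℚ (Place.Completion (Sum.inr ((primesEquiv (R := 𝓞 ℚ)).symm ⟨p, hp.out⟩) : Place ℚ)) (w.1.adicCompletion (CyclotomicField m ℚ)))⁻¹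
  obtain ⟨gV', hgV'def⟩ := exists_ratGalEquiv W (p := p) (towerConjElement ℚ (w.1.adicCompletion (CyclotomicField m ℚ)) K')⁻¹
  -- §2 de Rham ASCENT `ℚ_v → L_w → K′` for the direct representations, then the tower representation over `K′` along `V(γ′⁻¹)`
  have hDRL : GaloisRep.IsDeRham (bdRPeriodRingData (F := (w.1.adicCompletion (CyclotomicField m ℚ))) (p := p) hL) (restrictedRationalTateRep W (w.1.adicCompletion (CyclotomicField m ℚ)) p) :=
    isDeRham_restrictedRationalTateRep_of_tower W hcont (valuation_place_lt_one p ((primesEquiv (R := 𝓞 ℚ)).symm ⟨p, hp.out⟩)) hL hDRv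
  have hDRK : GaloisRep.IsDeRham (bdRPeriodRingData (F := K') (p := p) hp') (restrictedRationalTateRep W K' p) :=
    isDeRham_restrictedRationalTateRep_of_tower W hcont' hL hp' hDRL
  have hDRT : GaloisRep.IsDeRham (bdRPeriodRingData (F := K') (p := p) hp')
      ((restrictedRationalTateRep W (w.1.adicCompletion (CyclotomicField m ℚ)) p).restrict (absGaloisRestrict (w.1.adicCompletion (CyclotomicField m ℚ)) K')) :=
    ((bdRPeriodRingData (F := K') (p := p) hp').isAdmissible_iff_of_equiv
      ((restrictedRationalTateRep W (w.1.adicCompletion (CyclotomicField m ℚ)) p).restrict (absGaloisRestrict (w.1.adicCompletion (CyclotomicField m ℚ)) K')) (restrictedRationalTateRep W K' p) gV'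
      (ratGalEquiv_intertwines W (w.1.adicCompletion (CyclotomicField m ℚ)) (absGaloisRestrict_eq_conj_towerConjElement_inv (w.1.adicCompletion (CyclotomicField m ℚ)) K') hgV'def)).2 hDRK
  -- §3 the Prop-1.2.3 binders over `L_w` (direct) and over `K′` (tower), Kato II Prop. 1.2.3
  obtain ⟨hinjL, hdeL⟩ := cupLogInjective_and_hasDualExp_of_isDeRham_holds hL (restrictedRationalTateRep W (w.1.adicCompletion (CyclotomicField m ℚ)) p) hDRL
  obtain ⟨hinj', hde'⟩ := cupLogInjective_and_hasDualExp_of_isDeRham_holds hp'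
    ((restrictedRationalTateRep W (w.1.adicCompletion (CyclotomicField m ℚ)) p).restrict (absGaloisRestrict (w.1.adicCompletion (CyclotomicField m ℚ)) K')) hDRT
  -- §4 a line datum over `K′` EXISTS (`dim D⁰_dR = 1`: two-dimensional, de Rham, `det = χ`)
  have hdet : ∀ σ : absoluteGaloisGroup K',
      LinearMap.det ((((restrictedRationalTateRep W (w.1.adicCompletion (CyclotomicField m ℚ)) p).restrict (absGaloisRestrict (w.1.adicCompletion (CyclotomicField m ℚ)) K')) σ :
        W.rationalTateModule p →ₗ[ℚ_[p]] W.rationalTateModule p)) = (((GaloisRep.cyclotomicCharacter K' p σ : ℤ_[p]ˣ) : ℤ_[p]) : ℚ_[p]) := by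
    intro σ
    haveI : NeZero (p : (w.1.adicCompletion (CyclotomicField m ℚ))) := ⟨Nat.cast_ne_zero.mpr hp.out.ne_zero⟩
    rw [ContinuousRep.restrict_apply, det_restrictedRationalTateRep_eq_cyclotomicCharacter, cyclotomicCharacter_absGaloisRestrict]
  have hne : Nonempty ((bdRPeriodRingData (F := K') (p := p) hp').FilZeroLine
      ((restrictedRationalTateRep W (w.1.adicCompletion (CyclotomicField m ℚ)) p).restrict (absGaloisRestrict (w.1.adicCompletion (CyclotomicField m ℚ)) K'))) :=
    nonempty_filZeroLine_of_isDeRham_of_det hp' _ (finrank_rationalTateModule_eq_two_holds W p hp0) hDRT hdet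
  -- §5 (RES) at the base `L_w`: the transported line datum `d′` over `K′`, compatible with `d.map V(γ⁻¹)`
  obtain ⟨d', hd'⟩ := exists_localNeronLine_expStarOmega_res (K := (w.1.adicCompletion (CyclotomicField m ℚ))) (L := K') hL hp' W (absGaloisRestrict ℚ (w.1.adicCompletion (CyclotomicField m ℚ))) hcont'
    (d.map gV (ratGalEquiv_intertwines W (Place.Completion (Sum.inr ((primesEquiv (R := 𝓞 ℚ)).symm ⟨p, hp.out⟩) : Place ℚ)) (absGaloisRestrict_eq_conj_towerConjElement_inv (Place.Completion (Sum.inr ((primesEquiv (R := 𝓞 ℚ)).symm ⟨p, hp.out⟩) : Place ℚ)) (w.1.adicCompletion (CyclotomicField m ℚ))) hgVdef)) hne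
  have hcomp' : ∀ (η : contOneCocycles (restrictedTateRep W (w.1.adicCompletion (CyclotomicField m ℚ)) p).toTopRep)
      (η' : contOneCocycles ((restrictedTateRep W (w.1.adicCompletion (CyclotomicField m ℚ)) p).restrict (absGaloisRestrict (w.1.adicCompletion (CyclotomicField m ℚ)) K')).toTopRep),
      (∀ σ, η'.1 σ = η.1 (absGaloisRestrict (w.1.adicCompletion (CyclotomicField m ℚ)) K' σ)) →
      expStarCoordTower W (F₀ := (w.1.adicCompletion (CyclotomicField m ℚ))) hp' d' η' =
        algebraMap (w.1.adicCompletion (CyclotomicField m ℚ)) K' (expStarCoord W hL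
          (d.map gV (ratGalEquiv_intertwines W (Place.Completion (Sum.inr ((primesEquiv (R := 𝓞 ℚ)).symm ⟨p, hp.out⟩) : Place ℚ)) (absGaloisRestrict_eq_conj_towerConjElement_inv (Place.Completion (Sum.inr ((primesEquiv (R := 𝓞 ℚ)).symm ⟨p, hp.out⟩) : Place ℚ)) (w.1.adicCompletion (CyclotomicField m ℚ))) hgVdef)) η) := by
    intro η η' hη'
    -- the restricted crossed homomorphism `η ∘ res` as a cocycle of `T_pW|_{r ∘ res}` (same type as the tower representation, `rfl`)
    let ηp : contOneCocycles (localTateRep W p ((absGaloisRestrict ℚ (w.1.adicCompletion (CyclotomicField m ℚ))).comp (absGaloisRestrict (w.1.adicCompletion (CyclotomicField m ℚ)) K'))).toTopRep :=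
      contOneCocycles.pullback (absGaloisRestrict (w.1.adicCompletion (CyclotomicField m ℚ)) K')
        (Y := ((localTateRep W p (absGaloisRestrict ℚ (w.1.adicCompletion (CyclotomicField m ℚ)))).restrict (absGaloisRestrict (w.1.adicCompletion (CyclotomicField m ℚ)) K')).toTopRep)
        (TopRep.ofHom ⟨ContinuousLinearMap.id ℤ (W.tateModule p), fun _ => rfl⟩) η
    have hres : (localTateRep W p (absGaloisRestrict ℚ (w.1.adicCompletion (CyclotomicField m ℚ)))).cohomologyRes (absGaloisRestrict (w.1.adicCompletion (CyclotomicField m ℚ)) K') 1 (oneCocycleClass _ η) =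
        oneCocycleClass (localTateRep W p ((absGaloisRestrict ℚ (w.1.adicCompletion (CyclotomicField m ℚ))).comp (absGaloisRestrict (w.1.adicCompletion (CyclotomicField m ℚ)) K'))).toTopRep ηp :=
      cohomologyRes_oneCocycleClass _ _ η
    have key := hd' hinjL hinj' hdeL (oneCocycleClass _ η)
    rw [hres, expStarOmega_oneCocycleClass, expStarOmega_oneCocycleClass] at key
    refine Eq.trans ?_ key
    unfold expStarCoordTower
    exact congrArg _ (funext fun σ => by rw [hη']; rfl)
  -- §6 `log_ω` along the two extensions: AUTOMATIC CONTINUITY makes the restricted valuations compatible, then the isometric-pair lemma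
  haveI : ValuativeExtension (Place.Completion (Sum.inr ((primesEquiv (R := 𝓞 ℚ)).symm ⟨p, hp.out⟩) : Place ℚ)) (w.1.adicCompletion (CyclotomicField m ℚ)) := valuativeExtension_of_cast_residueFieldCard_eq_zero cast_residueFieldCard_eq_zero_of_algebra
  haveI : ValuativeExtension (w.1.adicCompletion (CyclotomicField m ℚ)) K' := valuativeExtension_of_cast_residueFieldCard_eq_zero cast_residueFieldCard_eq_zero_of_algebra
  have hlog : ∀ P₀ : (W.baseChange (Place.Completion (Sum.inr ((primesEquiv (R := 𝓞 ℚ)).symm ⟨p, hp.out⟩) : Place ℚ))).toAffine.Point,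
      padicLogPointFiniteExt ν (W.baseChange (w.1.adicCompletion (CyclotomicField m ℚ))) p (WeierstrassCurve.Affine.Point.map (IsScalarTower.toAlgHom ℚ (Place.Completion (Sum.inr ((primesEquiv (R := 𝓞 ℚ)).symm ⟨p, hp.out⟩) : Place ℚ)) (w.1.adicCompletion (CyclotomicField m ℚ))) P₀) =
        algebraMap (Place.Completion (Sum.inr ((primesEquiv (R := 𝓞 ℚ)).symm ⟨p, hp.out⟩) : Place ℚ)) (w.1.adicCompletion (CyclotomicField m ℚ)) (padicLogPointFiniteExt wv (W.baseChange (Place.Completion (Sum.inr ((primesEquiv (R := 𝓞 ℚ)).symm ⟨p, hp.out⟩) : Place ℚ))) p P₀) := by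
    intro P₀
    haveI := ValuativeExtension.compatible_comap (Place.Completion (Sum.inr ((primesEquiv (R := 𝓞 ℚ)).symm ⟨p, hp.out⟩) : Place ℚ)) ν
    have hiso : wv.IsEquiv (ν.comap (algebraMap (Place.Completion (Sum.inr ((primesEquiv (R := 𝓞 ℚ)).symm ⟨p, hp.out⟩) : Place ℚ)) (w.1.adicCompletion (CyclotomicField m ℚ)))) := ValuativeRel.isEquiv _ _
    haveI := isIntegral_of_isEquiv hiso (W.baseChange (Place.Completion (Sum.inr ((primesEquiv (R := 𝓞 ℚ)).symm ⟨p, hp.out⟩) : Place ℚ)))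
    have hν₀ : ν.comap (algebraMap (Place.Completion (Sum.inr ((primesEquiv (R := 𝓞 ℚ)).symm ⟨p, hp.out⟩) : Place ℚ)) (w.1.adicCompletion (CyclotomicField m ℚ))) (p : (Place.Completion (Sum.inr ((primesEquiv (R := 𝓞 ℚ)).symm ⟨p, hp.out⟩) : Place ℚ))) < 1 :=
      (ValuativeRel.isEquiv (ν.comap (algebraMap (Place.Completion (Sum.inr ((primesEquiv (R := 𝓞 ℚ)).symm ⟨p, hp.out⟩) : Place ℚ)) (w.1.adicCompletion (CyclotomicField m ℚ)))) (valuation (Place.Completion (Sum.inr ((primesEquiv (R := 𝓞 ℚ)).symm ⟨p, hp.out⟩) : Place ℚ)))).lt_one_iff_lt_one.mpr (valuation_place_lt_one p ((primesEquiv (R := 𝓞 ℚ)).symm ⟨p, hp.out⟩))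
    rw [padicLogPointFiniteExt_eq_of_isEquiv (V := W.baseChange (Place.Completion (Sum.inr ((primesEquiv (R := 𝓞 ℚ)).symm ⟨p, hp.out⟩) : Place ℚ))) hiso p]
    exact padicLogPointFiniteExt_map_toAlgHom W (Place.Completion (Sum.inr ((primesEquiv (R := 𝓞 ℚ)).symm ⟨p, hp.out⟩) : Place ℚ)) (valuation_place_lt_one p ((primesEquiv (R := 𝓞 ℚ)).symm ⟨p, hp.out⟩)) (ν.comap (algebraMap (Place.Completion (Sum.inr ((primesEquiv (R := 𝓞 ℚ)).symm ⟨p, hp.out⟩) : Place ℚ)) (w.1.adicCompletion (CyclotomicField m ℚ)))) (w.1.adicCompletion (CyclotomicField m ℚ)) hL ν hν₀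
      (fun _ => rfl) P₀
  have hlog' : ∀ P : (W.baseChange (w.1.adicCompletion (CyclotomicField m ℚ))).toAffine.Point,
      padicLogPointFiniteExt w' (W.baseChange K') p (WeierstrassCurve.Affine.Point.map (IsScalarTower.toAlgHom ℚ (w.1.adicCompletion (CyclotomicField m ℚ)) K') P) =
        algebraMap (w.1.adicCompletion (CyclotomicField m ℚ)) K' (padicLogPointFiniteExt ν (W.baseChange (w.1.adicCompletion (CyclotomicField m ℚ))) p P) := by
    intro P
    haveI := ValuativeExtension.compatible_comap (w.1.adicCompletion (CyclotomicField m ℚ)) w'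
    have hiso : ν.IsEquiv (w'.comap (algebraMap (w.1.adicCompletion (CyclotomicField m ℚ)) K')) := ValuativeRel.isEquiv _ _
    haveI := isIntegral_of_isEquiv hiso (W.baseChange (w.1.adicCompletion (CyclotomicField m ℚ)))
    have hν₀ : w'.comap (algebraMap (w.1.adicCompletion (CyclotomicField m ℚ)) K') (p : (w.1.adicCompletion (CyclotomicField m ℚ))) < 1 :=
      (ValuativeRel.isEquiv (w'.comap (algebraMap (w.1.adicCompletion (CyclotomicField m ℚ)) K')) (valuation (w.1.adicCompletion (CyclotomicField m ℚ)))).lt_one_iff_lt_one.mpr hL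
    rw [padicLogPointFiniteExt_eq_of_isEquiv (V := W.baseChange (w.1.adicCompletion (CyclotomicField m ℚ))) hiso p]
    exact padicLogPointFiniteExt_map_toAlgHom W (w.1.adicCompletion (CyclotomicField m ℚ)) hL (w'.comap (algebraMap (w.1.adicCompletion (CyclotomicField m ℚ)) K')) K' hp' w' hν₀ (fun _ => rfl) P
  -- §7 Kato's formula over `K′` at the transported line `d′.map V(γ′⁻¹)`, then the from-above theorem in the packet keys
  obtain ⟨c', hrec'⟩ := hrecK' (d'.map gV' (ratGalEquiv_intertwines W (w.1.adicCompletion (CyclotomicField m ℚ)) (absGaloisRestrict_eq_conj_towerConjElement_inv (w.1.adicCompletion (CyclotomicField m ℚ)) K') hgV'def))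
  exact recTowerAt_cyclotomic_of_formula_above W p m w hw hL wv ν hp' w' e hμ hadd₁ hadd₂ hgal hcompat hgVdef hgV'def hnondeg hinj hde
    hinj' hde' d₀ d d' hcomp hcomp' hlog hlog' c' hrec'

/-- ★ **The de Rham input `hDRv` HOLDS on the six starred K★ cells**, in the packet keys of `ℚ_v`: for a globally minimal `W/ℚ` with
`p ∈ {5, 7}`, additive reduction at `p`, `E[p]` irreducible, no `Iₙ*` fibre at `p` and `4 < ord_p Δ_min`, `V_pW|_{Γ_{ℚ_v}}` is de Rham —
the tree's cell theorems (`isDeRham_restrictedRationalTateRep_adicCompletion_rat_of_starred_fiveSeven_ordinary` on the (G)-ordinary half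
`p = 5 ↔ ord_p Δ_min = 9`, `isDeRham_supersingularCells_of_explicitCapstone explicitCapstone_holds` on the potentially supersingular half),
read for the tree's `ℚ`-algebra structure `Place.instAlgebraCompletion` on `ℚ_v` (any two `ℚ`-algebra structures on a ring coincide).
[cite: Fontaine1982FormesDifferentielles, §5] [cite: DokchitserDokchitser2015LocalInvariants, Thm. 3.2] [cite: Kato1993LNM1553, Ch. II Ex. 1.3.5] -/
theorem isDeRham_place_of_starredCell [W.IsGloballyMinimal] (hp57 : p = 5 ∨ p = 7) (hadd : Addv W p) (hirr : Irr W p)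
    (hIstar : ∀ (v : HeightOneSpectrum ℤ) (n : ℕ), natGenerator v = p → W.kodairaSymbolAt v ≠ KodairaSymbol.Istar n)
    (h4 : 4 < padicValInt p W.minimalDiscriminantInt) :
    GaloisRep.IsDeRham (bdRPeriodRingData (valuation_place_lt_one p ((primesEquiv (R := 𝓞 ℚ)).symm ⟨p, hp.out⟩)))
      (localRationalTateRep W p (galRestrictPlace ((primesEquiv (R := 𝓞 ℚ)).symm ⟨p, hp.out⟩))) := by
  -- any two `ℚ`-algebra structures on `ℚ_v` coincide, so the restricted representation does not depend on the choice
  have hrep : ∀ (i₁ i₂ : Algebra ℚ (((primesEquiv (R := 𝓞 ℚ)).symm ⟨p, hp.out⟩).adicCompletion ℚ)),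
      @restrictedRationalTateRep ℚ _ W _ _ i₁ p _ _ = @restrictedRationalTateRep ℚ _ W _ _ i₂ p _ _ :=
    fun i₁ i₂ ↦ by rw [Subsingleton.elim i₁ i₂]
  by_cases hord : (p = 5 ↔ padicValInt p W.minimalDiscriminantInt = 9)
  · -- the (G)-ordinary half `(5; III*), (7; IV*), (7; II*)`
    have h0 := @isDeRham_restrictedRationalTateRep_adicCompletion_rat_of_starred_fiveSeven_ordinary W _ _ p _ hp57 hadd hIstar h4 hord
      ((primesEquiv (R := 𝓞 ℚ)).symm ⟨p, hp.out⟩) (fact_natCast_mem_primesEquiv_symm p).out (charZero_place _)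
      (@fact_not_isUnit_place p _ (fact_natCast_mem_primesEquiv_symm p)) (@isAdicComplete_place p _ _ (fact_natCast_mem_primesEquiv_symm p))
      (@valuation_place_lt_one p _ (fact_natCast_mem_primesEquiv_symm p)) (@padicAlgebraPlace p _ _ (fact_natCast_mem_primesEquiv_symm p))
    have h1 := (hrep (@DivisionRing.toRatAlgebra _ _ (charZero_place _)) (Place.instAlgebraCompletion (Sum.inr ((primesEquiv (R := 𝓞 ℚ)).symm ⟨p, hp.out⟩) : Place ℚ))) ▸ h0
    exact h1
  · -- the potentially supersingular half `(5; IV*), (5; II*), (7; III*)`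
    have h0 := @StarredOptimalManinUnitFiveSevenSupersingularCellsExplicit.isDeRham_supersingularCells_of_explicitCapstone
      StarredOptimalManinUnitFiveSevenSupersingularCellsDeRhamHolds.explicitCapstone_holds W _ _ p _ hp57 hadd hirr hIstar h4 hord
      ((primesEquiv (R := 𝓞 ℚ)).symm ⟨p, hp.out⟩) (fact_natCast_mem_primesEquiv_symm p).out (charZero_place _)
      (@fact_not_isUnit_place p _ (fact_natCast_mem_primesEquiv_symm p)) (@isAdicComplete_place p _ _ (fact_natCast_mem_primesEquiv_symm p))
      (@valuation_place_lt_one p _ (fact_natCast_mem_primesEquiv_symm p)) (@padicAlgebraPlace p _ _ (fact_natCast_mem_primesEquiv_symm p))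
    have h1 := (hrep (@DivisionRing.toRatAlgebra _ _ (charZero_place _)) (Place.instAlgebraCompletion (Sum.inr ((primesEquiv (R := 𝓞 ℚ)).symm ⟨p, hp.out⟩) : Place ℚ))) ▸ h0
    exact h1

set_option backward.isDefEq.respectTransparency false in
/-- ★★★ **The same ON THE SIX STARRED K★ CELLS, de Rham input DISCHARGED**: for a globally minimal `W/ℚ` IN a K★ cell — `p ∈ {5, 7}`,
additive at `p`, `E[p]` irreducible, no `Iₙ*` fibre at `p`, `4 < ord_p Δ_min` (both halves; NO selector) — the [REC-tower] body clause at the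
cyclotomic tower `ℚ_v ⊆ ℚ(ζ_m)_w` follows from Kato's formula over ANY finite `K′ ⊇ ℚ(ζ_m)_w` as in `recTowerAt_cyclotomic_of_formula_over_ext`
(`hDRv := isDeRham_place_of_starredCell`). So each intrinsic REC stub of skeleton v8 ⟸ (a finite `K′ ⊇ ℚ(ζ_m)_w` with keys) + Kato's formula
over `K′` for the direct representation, `∀ d″ ∃ c′` — and nothing else.
[cite: Kato1993LNM1553, Ch. II §1.2.4, Prop. 1.2.3, Ex. 1.3.5 and Thm. 1.4.1 (4)] [cite: BrinonConrad2009, Prop. 6.3.8]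
[cite: DokchitserDokchitser2015LocalInvariants, Thm. 3.2] [cite: Fontaine1982FormesDifferentielles, §5] -/
theorem recTowerAt_cyclotomic_cells_of_formula_over_ext [W.IsGloballyMinimal]
    (hp57 : p = 5 ∨ p = 7) (hadd : Addv W p) (hirr : Irr W p)
    (hIstar : ∀ (v : HeightOneSpectrum ℤ) (n : ℕ), natGenerator v = p → W.kodairaSymbolAt v ≠ KodairaSymbol.Istar n)
    (h4 : 4 < padicValInt p W.minimalDiscriminantInt)
    (m : ℕ) [NeZero m]
    (w : ((primesEquiv (R := 𝓞 ℚ)).symm ⟨p, hp.out⟩).Extension (𝓞 (CyclotomicField m ℚ)))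
    (hw : ((p : ℕ) : 𝓞 (CyclotomicField m ℚ)) ∈ w.1.asIdeal)
    [CharZero (w.1.adicCompletion (CyclotomicField m ℚ))]
    [Fact (¬ IsUnit ((p : ℕ) : integerC (w.1.adicCompletion (CyclotomicField m ℚ))))]
    [IsAdicComplete (Ideal.span {((p : ℕ) : integerC (w.1.adicCompletion (CyclotomicField m ℚ)))}) (integerC (w.1.adicCompletion (CyclotomicField m ℚ)))]
    (hL : valuation (w.1.adicCompletion (CyclotomicField m ℚ)) ((p : ℕ) : (w.1.adicCompletion (CyclotomicField m ℚ))) < 1) :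
    letI := LocalField.adicCompletionPadicAlgebra w.1 p hw
    letI : Algebra (Place.Completion (K := ℚ) (Sum.inr ((primesEquiv (R := 𝓞 ℚ)).symm ⟨p, hp.out⟩))) (w.1.adicCompletion (CyclotomicField m ℚ)) :=
      inferInstanceAs (Algebra (((primesEquiv (R := 𝓞 ℚ)).symm ⟨p, hp.out⟩).adicCompletion ℚ) (w.1.adicCompletion (CyclotomicField m ℚ)))
    ∀ (wv : Valuation (Place.Completion (Sum.inr ((primesEquiv (R := 𝓞 ℚ)).symm ⟨p, hp.out⟩) : Place ℚ)) ℝ≥0) [wv.Compatible] [(W.baseChange (Place.Completion (Sum.inr ((primesEquiv (R := 𝓞 ℚ)).symm ⟨p, hp.out⟩) : Place ℚ))).IsIntegral wv.integer]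
      (ν : Valuation (w.1.adicCompletion (CyclotomicField m ℚ)) ℝ≥0) [ν.Compatible] [(W.baseChange (w.1.adicCompletion (CyclotomicField m ℚ))).IsIntegral ν.integer]
      -- the ABSTRACT upper field `K′ ⊇ L_w` with the CANONICAL `ℚ_p`-structure
      {K' : Type} [Field K'] [Algebra ℚ K'] [Algebra (w.1.adicCompletion (CyclotomicField m ℚ)) K'] [IsScalarTower ℚ (w.1.adicCompletion (CyclotomicField m ℚ)) K'] [ValuativeRel K'] [TopologicalSpace K']
      [IsNonarchimedeanLocalField K'] [CharZero K'] [Fact (¬ IsUnit (p : integerC K'))]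
      [IsAdicComplete (Ideal.span {(p : integerC K')}) (integerC K')]
      (hp' : valuation K' p < 1) (hcont' : Continuous (algebraMap (w.1.adicCompletion (CyclotomicField m ℚ)) K')) [FiniteDimensional (w.1.adicCompletion (CyclotomicField m ℚ)) K']
      (w' : Valuation K' ℝ≥0) [w'.Compatible] [(W.baseChange K').IsIntegral w'.integer],
    letI := LocalField.padicAlgebra K' p hp'
    -- the Weil tower
    ∀ (e : (k : ℕ) → geomTorsion W ((p ^ k : ℕ) : ℤ) → geomTorsion W ((p ^ k : ℕ) : ℤ) → AlgebraicClosure ℚ)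
    (hμ : ∀ k S T, e k S T ^ (p ^ k) = 1) (hadd₁ : ∀ k S₁ S₂ T, e k (S₁ + S₂) T = e k S₁ T * e k S₂ T)
    (hadd₂ : ∀ k S T₁ T₂, e k S (T₁ + T₂) = e k S T₁ * e k S T₂)
    (hgal : ∀ k (σ : absoluteGaloisGroup ℚ) (S T : geomTorsion W ((p ^ k : ℕ) : ℤ)), σ • e k S T = e k (σ • S) (σ • T))
    (hcompat : ∀ k (S T : geomTorsion W ((p ^ (k + 1) : ℕ) : ℤ)),
      e k (torsionMulHom W (p ^ (k + 1)) (p ^ k) p (pow_succ p k).symm S)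
        (torsionMulHom W (p ^ (k + 1)) (p ^ k) p (pow_succ p k).symm T) = e (k + 1) S T ^ p)
    (hnondeg : ∀ k (T : geomTorsion W ((p ^ k : ℕ) : ℤ)), (∀ S, e k S T = 1) → T = 0)
    -- binders of the tower representation over `F = L_w` (relative to `F₀ = ℚ_v`) — the stub's own
    (hinj : (bdRPeriodRingData (F := (w.1.adicCompletion (CyclotomicField m ℚ))) (p := p) hL).CupLogInjective (logCyclotomic p)
      ((restrictedRationalTateRep W (Place.Completion (Sum.inr ((primesEquiv (R := 𝓞 ℚ)).symm ⟨p, hp.out⟩) : Place ℚ)) p).restrict (absGaloisRestrict (Place.Completion (Sum.inr ((primesEquiv (R := 𝓞 ℚ)).symm ⟨p, hp.out⟩) : Place ℚ)) (w.1.adicCompletion (CyclotomicField m ℚ)))))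
    (hde : ∀ z : contOneCocycles ((restrictedRationalTateRep W (Place.Completion (Sum.inr ((primesEquiv (R := 𝓞 ℚ)).symm ⟨p, hp.out⟩) : Place ℚ)) p).restrict (absGaloisRestrict (Place.Completion (Sum.inr ((primesEquiv (R := 𝓞 ℚ)).symm ⟨p, hp.out⟩) : Place ℚ)) (w.1.adicCompletion (CyclotomicField m ℚ)))).toTopRep,
      (bdRPeriodRingData (F := (w.1.adicCompletion (CyclotomicField m ℚ))) (p := p) hL).HasDualExp (logCyclotomic p)
        ((restrictedRationalTateRep W (Place.Completion (Sum.inr ((primesEquiv (R := 𝓞 ℚ)).symm ⟨p, hp.out⟩) : Place ℚ)) p).restrict (absGaloisRestrict (Place.Completion (Sum.inr ((primesEquiv (R := 𝓞 ℚ)).symm ⟨p, hp.out⟩) : Place ℚ)) (w.1.adicCompletion (CyclotomicField m ℚ)))) fun σ => z.1 σ)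
    -- line data at `ℚ_v` and `L_w` with their compatibility — the stub's own
    (d₀ : (bdRPeriodRingData (F := (Place.Completion (Sum.inr ((primesEquiv (R := 𝓞 ℚ)).symm ⟨p, hp.out⟩) : Place ℚ))) (p := p) (valuation_place_lt_one p ((primesEquiv (R := 𝓞 ℚ)).symm ⟨p, hp.out⟩))).FilZeroLine (restrictedRationalTateRep W (Place.Completion (Sum.inr ((primesEquiv (R := 𝓞 ℚ)).symm ⟨p, hp.out⟩) : Place ℚ)) p))
    (d : (bdRPeriodRingData (F := (w.1.adicCompletion (CyclotomicField m ℚ))) (p := p) hL).FilZeroLine ((restrictedRationalTateRep W (Place.Completion (Sum.inr ((primesEquiv (R := 𝓞 ℚ)).symm ⟨p, hp.out⟩) : Place ℚ)) p).restrict (absGaloisRestrict (Place.Completion (Sum.inr ((primesEquiv (R := 𝓞 ℚ)).symm ⟨p, hp.out⟩) : Place ℚ)) (w.1.adicCompletion (CyclotomicField m ℚ)))))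
    (hcomp : ∀ (η₀ : contOneCocycles (restrictedTateRep W (Place.Completion (Sum.inr ((primesEquiv (R := 𝓞 ℚ)).symm ⟨p, hp.out⟩) : Place ℚ)) p).toTopRep)
        (η : contOneCocycles ((restrictedTateRep W (Place.Completion (Sum.inr ((primesEquiv (R := 𝓞 ℚ)).symm ⟨p, hp.out⟩) : Place ℚ)) p).restrict (absGaloisRestrict (Place.Completion (Sum.inr ((primesEquiv (R := 𝓞 ℚ)).symm ⟨p, hp.out⟩) : Place ℚ)) (w.1.adicCompletion (CyclotomicField m ℚ)))).toTopRep),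
        (∀ σ, η.1 σ = η₀.1 (absGaloisRestrict (Place.Completion (Sum.inr ((primesEquiv (R := 𝓞 ℚ)).symm ⟨p, hp.out⟩) : Place ℚ)) (w.1.adicCompletion (CyclotomicField m ℚ)) σ)) →
        expStarCoordTower W hL d η = algebraMap (Place.Completion (Sum.inr ((primesEquiv (R := 𝓞 ℚ)).symm ⟨p, hp.out⟩) : Place ℚ)) (w.1.adicCompletion (CyclotomicField m ℚ)) (expStarCoord W (valuation_place_lt_one p ((primesEquiv (R := 𝓞 ℚ)).symm ⟨p, hp.out⟩)) d₀ η₀))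
    -- Kato's formula over `K′` for the DIRECT representation: for every line datum SOME constant (the (K₂)^ram road's output shape)
    (hrecK' : ∀ d'' : (bdRPeriodRingData (F := K') (p := p) hp').FilZeroLine (restrictedRationalTateRep W K' p), ∃ c' : K',
      ∀ (η'' : contOneCocycles (restrictedTateRep W K' p).toTopRep) (P' : (W.baseChange K').toAffine.Point),
      ((tatePairingPoint W K' p e hμ hadd₁ hadd₂ hgal hcompat (oneCocycleClass _ η'') P' : ℤ_[p]) : ℚ_[p]) =
        Algebra.trace ℚ_[p] K' (c' * expStarCoord W hp' d'' η'' * padicLogPointFiniteExt w' (W.baseChange K') p P')),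
    ∃ c₀ : (Place.Completion (Sum.inr ((primesEquiv (R := 𝓞 ℚ)).symm ⟨p, hp.out⟩) : Place ℚ)), c₀ ≠ 0 ∧
      (∀ (η₀ : contOneCocycles (restrictedTateRep W (Place.Completion (Sum.inr ((primesEquiv (R := 𝓞 ℚ)).symm ⟨p, hp.out⟩) : Place ℚ)) p).toTopRep) (P₀ : (W.baseChange (Place.Completion (Sum.inr ((primesEquiv (R := 𝓞 ℚ)).symm ⟨p, hp.out⟩) : Place ℚ))).toAffine.Point),
        ((tatePairingPoint W (Place.Completion (Sum.inr ((primesEquiv (R := 𝓞 ℚ)).symm ⟨p, hp.out⟩) : Place ℚ)) p e hμ hadd₁ hadd₂ hgal hcompat (oneCocycleClass _ η₀) P₀ : ℤ_[p]) : ℚ_[p]) =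
          Algebra.trace ℚ_[p] (Place.Completion (Sum.inr ((primesEquiv (R := 𝓞 ℚ)).symm ⟨p, hp.out⟩) : Place ℚ))
            (c₀ * expStarCoord W (valuation_place_lt_one p ((primesEquiv (R := 𝓞 ℚ)).symm ⟨p, hp.out⟩)) d₀ η₀ * padicLogPointFiniteExt wv (W.baseChange (Place.Completion (Sum.inr ((primesEquiv (R := 𝓞 ℚ)).symm ⟨p, hp.out⟩) : Place ℚ))) p P₀)) ∧
      ∀ (η : contOneCocycles ((restrictedTateRep W (Place.Completion (Sum.inr ((primesEquiv (R := 𝓞 ℚ)).symm ⟨p, hp.out⟩) : Place ℚ)) p).restrict (absGaloisRestrict (Place.Completion (Sum.inr ((primesEquiv (R := 𝓞 ℚ)).symm ⟨p, hp.out⟩) : Place ℚ)) (w.1.adicCompletion (CyclotomicField m ℚ)))).toTopRep)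
        (P : (W.baseChange (w.1.adicCompletion (CyclotomicField m ℚ))).toAffine.Point),
        ((tatePairingPointTower W (Place.Completion (Sum.inr ((primesEquiv (R := 𝓞 ℚ)).symm ⟨p, hp.out⟩) : Place ℚ)) e hμ hadd₁ hadd₂ hgal hcompat (oneCocycleClass _ η) P : ℤ_[p]) : ℚ_[p]) =
          Algebra.trace ℚ_[p] (w.1.adicCompletion (CyclotomicField m ℚ))
            (algebraMap (Place.Completion (Sum.inr ((primesEquiv (R := 𝓞 ℚ)).symm ⟨p, hp.out⟩) : Place ℚ)) (w.1.adicCompletion (CyclotomicField m ℚ)) c₀ * expStarCoordTower W hL d η * padicLogPointFiniteExt ν (W.baseChange (w.1.adicCompletion (CyclotomicField m ℚ))) p P) :=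
  recTowerAt_cyclotomic_of_formula_over_ext W p (isDeRham_place_of_starredCell W p hp57 hadd hirr hIstar h4) m w hw hL

end Summit.BirchSwinnertonDyer.BirchSwinnertonDyer.Theorems.StarredOptimalManinUnitFiveSevenRecTowerAtCyclotomicOverExt

end
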